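import Literature.AlgebraicGeometry.HodgeTheory.AbelianVarietyWeilTypeAnalyticTrace
import Literature.AlgebraicGeometry.HodgeTheory.WeilClassesFieldRationalSpan
import Literature.AlgebraicGeometry.Deligne1982.WeilTypeCMHodgeRingHolds
import Mathlib.LinearAlgebra.Lagrange
import Mathlib.Algebra.DirectSum.LinearMap
import HarnessLib

/-!
# Moonen–Zarhin's multiplicities `n_σ` ARE «the multiplicity of `σ` on the tangent space»:
# `n_σ = dim Ker(t(φ) − σ(φ) | T₀A)`, `Σ_σ n_σ = dim A`, `Tr_a(Q(φ)) = Σ_σ n_σ Q(σ(φ))`, `n_σ = tr(e_σ | T₀A)`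

Family `hodge`, lane `lit-hodgefound` (seat p03, GEN 34 «the analytic representation ρ_a = Lie»), topic
`Literature/AlgebraicGeometry/HodgeTheory`.  Theorems only: no definition, no instance, no named fact (net Literature
debt 0).  Junction BY NAME of `HodgeTheory.eigenMultiplicity A φ ρ = dim (Ker(φ^* − ρ) ∩ H^{1,0}(A))` (the Weil-class
ladder's `n_σ`, `HodgeTheory/WeilClassesMoonenZarhinCriterion`; also the `a_σ` of `Deligne1982.IsWeilTypeCM`) with the
ANALYTIC REPRESENTATION `t(φ) = Motives.AbelianVariety.lieMap A φ` on `T₀A = Motives.AbelianVariety.Lie A`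
(`HodgeTheory/AbelianVarietyWeilTypeAnalyticTrace`: `dim (V_μ ∩ H^{1,0}) = dim Ker(t(φ) − μ)`).

## Sources (VERBATIM, held texts)

B. Moonen, Yu. Zarhin, *Weil classes on abelian varieties* [MoonenZarhin1998WeilClasses] (held
`paper:arxiv-alg-geom_9612017`, chunk p0001): «The action of `F` on `V_X` gives a decomposition of `V_ℂ = V_X ⊗_ℚ ℂ` as
`V_ℂ = ⊕_{σ ∈ Σ_F} V_{ℂ,σ} = ⊕_{σ ∈ Σ_F} (V^{1,0}_{ℂ,σ} ⊕ V^{0,1}_{ℂ,σ})`. The dimension `n_σ` of `V^{1,0}_{ℂ,σ}` is called the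
multiplicity of `σ` on the tangent space of `X`; we have `n_σ + n_{σ′} = 2g/[F:ℚ]` for all `σ ∈ Σ_F`» and the Criterion
«If `n_σ = n_{σ′}` for all `σ ∈ Σ_F` then `W_F` consists entirely of Hodge classes».  B. van Geemen, LNM 1594
[vanGeemen1994HodgeAV], 4.8 (chunk p0218): «`t : End(X)_ℚ → End(T₀X)`, `f ⊗ 1 ↦ t(f ⊗ 1) := df₀`».  P. Deligne (J. Milne),
*Hodge cycles on abelian varieties*, LNM 900 [Deligne1982HodgeCycles], §4 (4.4)–(4.5): `a_σ = dim H^{1,0}_σ`, «of Weil type if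
`a_σ = b_σ = d/2` for all `σ`».  G. Shimura [Shimura1998], §5.1–5.2: the representation of `F` on the invariant differential
forms `𝔇₀(A)` is `Σ_i φ_i` («`δι(α)ω_i = α^{φ_i} ω_i` … and the `ω_i` form a basis of `𝔇₀(A)`»), so its trace is `Σ_i α^{φ_i}`.

## What is proved

For a complex abelian variety `A`, an endomorphism `φ`, and (from §2 on) an integral polynomial `P` with `P(φ) = 0` in `End A`
whose complex roots are simple (`Squarefree P_ℂ`; e.g. `P` irreducible over `ℚ`: irreducible ⇒ separable in characteristic `0`) —
the field `F = ℚ(φ) = ℚ[T]/(P)`, embeddings `σ ↔` complex roots `z = σ(φ)`: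

* §1 **`eigenMultiplicity_eq_finrank_eigenspace_lieMap`**: `n_z = dim Ker(t(φ) − z | T₀A)` — the tree's `n_σ` (typed on
  `H^{1,0}`) IS «the multiplicity of `σ` on the tangent space of `X`»; `eigenMultiplicity_eq_finrank_eigenspace_cotangentMap`.
* §2 `aeval_lieMap_map_eq` / `aeval_lieMap_map_eq_zero` (`P(φ) = 0 ⇒ P(t(φ)) = 0`: `t` is a ring homomorphism), and with
  `T₀A = ⊕_{P(z)=0} Ker(t(φ) − z)` (semisimplicity): **`sum_eigenMultiplicity_eq_dim`** (`Σ_σ n_σ = dim A`),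
  **`trace_aeval_lieMap_eq_sum`** (`tr(Q(t(φ)) | T₀A) = Σ_z n_z Q(z)` for `Q ∈ ℂ[T]`), **`trace_lieMap_eq_sum_eigenMultiplicity_mul`**
  (`Tr_a(φ) = Σ_σ n_σ σ(φ)` — the analytic representation of `F` is `⊕_σ n_σ σ`), `trace_lieMap_eval₂_eq_sum` (`Tr_a(Q(φ)) =
  Σ_z n_z Q(z)` for `Q ∈ ℤ[T]`, i.e. on `ℤ[φ] ⊆ End A`), and **`eigenMultiplicity_eq_trace_aeval_lagrange`**
  (`n_{z₀} = tr(L_{z₀}(t(φ)) | T₀A)`, `L_{z₀}` the Lagrange interpolation polynomial at the roots: `n_σ` is the trace of the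
  idempotent `e_σ ∈ F ⊗ ℂ` on the tangent space).
* §3 Deligne's Weil-type CM data `IsWeilTypeCM A η R e₀ k` read on `T₀A`: `IsWeilTypeCM.finrank_eigenspace_lieMap_eq`
  (`dim Ker(t(η) − ρ) = k` at every root `ρ` of `P_R = R(T²)`), `IsWeilTypeCM.trace_lieMap_eval₂_eq`
  (`Tr_a(Q(η)) = k · Σ_ρ Q(ρ)`), and **`IsWeilTypeCM.trace_lieMap_eq_zero`** (`Tr_a(η) = 0`: the roots of `R(T²)` come in pairs
  `±ρ`, the tree's `IsWeilTypeCM.neg_root` / `root_ne_zero`) — the CM-field generalisation of `IsWeilType.trace_lieMap_eq_zero`.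

## References

* [MoonenZarhin1998WeilClasses] B. Moonen, Yu. Zarhin, *Weil classes on abelian varieties*, J. reine angew. Math. 496 (1998)
  83–92 = arXiv:alg-geom/9612017, §1 (chunk p0001).
* [vanGeemen1994HodgeAV] B. van Geemen, LNM 1594 (1994), 4.8–4.9 (chunk p0218).
* [Deligne1982HodgeCycles] P. Deligne (notes by J. S. Milne), LNM 900 (1982), §4 (4.4)–(4.5), Prop. 4.4.
* [Shimura1998] G. Shimura, *Abelian Varieties with Complex Multiplication and Modular Functions* (1998), §5.1–5.2 (p. 39),
  §2.8 (chunk p0027: the anti-representation `λ ↦ δλ` of `End(A; k)` on `𝔇₀(A; k)`).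
-/

noncomputable section

open CategoryTheory Module Polynomial
open Literature.AlgebraicTopology.SingularHomology
open Literature.AlgebraicGeometry.Motives (IsSmoothProjective)
open Literature.AlgebraicGeometry.Motives.AbelianVariety (Lie Cotangent lieMap cotangentMap lieMapRingHom lieMapRingHom_apply
  finrank_lie)

namespace Literature.AlgebraicGeometry.HodgeTheory

/-! ## §0 Linear algebra: an operator killed by a square-free polynomial -/

section LinearAlgebra

variable {M : Type*} [AddCommGroup M] [Module ℂ M] [FiniteDimensional ℂ M] {T : Module.End ℂ M} {R : ℂ[X]}

omit [FiniteDimensional ℂ M] in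
/-- The eigenvalues of an operator killed by `R` are roots of `R`. [folklore] -/
private theorem isRoot_of_eigenspace_ne_bot'' (hTR : aeval T R = 0) {μ : ℂ} (hμ : T.eigenspace μ ≠ ⊥) : R.IsRoot μ := by
  obtain ⟨v, hv, hv0⟩ := (Submodule.ne_bot_iff _).1 hμ
  have h := Module.End.aeval_apply_of_hasEigenvector (f := T) (p := R) (Module.End.hasEigenvector_iff.2 ⟨hv, hv0⟩)
  rw [hTR, LinearMap.zero_apply] at h
  exact (smul_eq_zero.1 h.symm).resolve_right hv0

/-- **`M = ⊕_{R(z) = 0} Ker(T − z)`** for an operator `T` killed by a square-free polynomial `R` over `ℂ` (`T` is semisimple,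
Mathlib `Module.End.isSemisimple_of_squarefree_aeval_eq_zero`). [folklore] -/
private theorem isInternal_eigenspace_of_aeval_eq_zero'' (hRsq : Squarefree R) (hTR : aeval T R = 0) :
    DirectSum.IsInternal fun z : R.roots.toFinset ↦ T.eigenspace (z : ℂ) := by
  classical
  have hss : T.IsSemisimple := Module.End.isSemisimple_of_squarefree_aeval_eq_zero hRsq hTR
  have htop : ⨆ μ, T.eigenspace μ = ⊤ := hss.iSup_eigenspace_eq_top
  have hind : iSupIndep fun z : R.roots.toFinset ↦ T.eigenspace (z : ℂ) :=
    (Module.End.eigenspaces_iSupIndep T).comp Subtype.val_injective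
  have hsup : (⨆ z : R.roots.toFinset, T.eigenspace (z : ℂ)) = ⊤ := by
    refine le_antisymm le_top ?_
    rw [← htop]
    refine iSup_le fun μ ↦ ?_
    by_cases hμ : T.eigenspace μ = ⊥
    · rw [hμ]; exact bot_le
    · exact le_iSup (fun z : R.roots.toFinset ↦ T.eigenspace (z : ℂ))
        ⟨μ, Multiset.mem_toFinset.2 ((Polynomial.mem_roots hRsq.ne_zero).2 (isRoot_of_eigenspace_ne_bot'' hTR hμ))⟩
  exact DirectSum.isInternal_submodule_of_iSupIndep_of_iSup_eq_top hind hsup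

omit [FiniteDimensional ℂ M] in
/-- `Q(T)` maps `Ker(T − z)` into itself. [folklore] -/
private theorem mapsTo_aeval_eigenspace (Q : ℂ[X]) (z : ℂ) :
    Set.MapsTo (aeval T Q) (T.eigenspace z) (T.eigenspace z) := by
  intro x hx
  rw [SetLike.mem_coe, Module.End.mem_eigenspace_iff] at hx ⊢
  rw [Module.End.aeval_apply_of_mem_apply_eq_smul hx, map_smul, hx, smul_comm]

/-- On `Ker(T − z)` the operator `Q(T)` is the scalar `Q(z)`, so its trace there is `Q(z) · dim Ker(T − z)`. [folklore] -/
private theorem trace_restrict_aeval_eigenspace (Q : ℂ[X]) (z : ℂ) :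
    LinearMap.trace ℂ _ ((aeval T Q).restrict (mapsTo_aeval_eigenspace Q z)) =
      Q.eval z * finrank ℂ ↥(T.eigenspace z) := by
  have e : (aeval T Q).restrict (mapsTo_aeval_eigenspace Q z) = Q.eval z • LinearMap.id := by
    refine LinearMap.ext fun x ↦ Subtype.ext ?_
    rw [LinearMap.restrict_apply, LinearMap.smul_apply, LinearMap.id_apply, Submodule.coe_smul]
    exact Module.End.aeval_apply_of_mem_apply_eq_smul (Module.End.mem_eigenspace_iff.1 x.2)
  rw [e, map_smul, LinearMap.trace_id, smul_eq_mul]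

/-- **`tr(Q(T) | M) = Σ_{R(z) = 0} dim Ker(T − z) · Q(z)`** for `T` killed by a square-free `R`. [folklore] -/
private theorem trace_aeval_eq_sum_of_squarefree (hRsq : Squarefree R) (hTR : aeval T R = 0) (Q : ℂ[X]) :
    LinearMap.trace ℂ M (aeval T Q) = ∑ z ∈ R.roots.toFinset, (finrank ℂ ↥(T.eigenspace z) : ℂ) * Q.eval z := by
  classical
  rw [LinearMap.trace_eq_sum_trace_restrict (isInternal_eigenspace_of_aeval_eq_zero'' hRsq hTR)
    (fun z ↦ mapsTo_aeval_eigenspace Q (z : ℂ))]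
  rw [← Finset.sum_coe_sort R.roots.toFinset]
  exact Finset.sum_congr rfl fun z _ ↦ by rw [trace_restrict_aeval_eigenspace, mul_comm]

/-- `dim M = Σ_{R(z) = 0} dim Ker(T − z)`. [folklore] -/
private theorem finrank_eq_sum_of_squarefree (hRsq : Squarefree R) (hTR : aeval T R = 0) :
    (finrank ℂ M : ℂ) = ∑ z ∈ R.roots.toFinset, (finrank ℂ ↥(T.eigenspace z) : ℂ) := by
  have h := trace_aeval_eq_sum_of_squarefree hRsq hTR 1
  simp only [map_one, eval_one, mul_one] at h
  rwa [Module.End.one_eq_id, LinearMap.trace_id] at h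

/-- `tr T = Σ_{R(z) = 0} dim Ker(T − z) · z`. [folklore] -/
private theorem trace_eq_sum_of_squarefree (hRsq : Squarefree R) (hTR : aeval T R = 0) :
    LinearMap.trace ℂ M T = ∑ z ∈ R.roots.toFinset, (finrank ℂ ↥(T.eigenspace z) : ℂ) * z := by
  have h := trace_aeval_eq_sum_of_squarefree hRsq hTR X
  simp only [aeval_X, eval_X] at h
  exact h

/-- `dim Ker(T − z₀) = tr(L_{z₀}(T))` for the Lagrange polynomial `L_{z₀}` at the roots of `R` (`L_{z₀}(z) = δ_{z z₀}`). [folklore] -/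
private theorem finrank_eigenspace_eq_trace_aeval_lagrange (hRsq : Squarefree R) (hTR : aeval T R = 0) {z₀ : ℂ}
    (hz₀ : z₀ ∈ R.roots.toFinset) :
    (finrank ℂ ↥(T.eigenspace z₀) : ℂ) = LinearMap.trace ℂ M (aeval T (Lagrange.basis R.roots.toFinset id z₀)) := by
  classical
  rw [trace_aeval_eq_sum_of_squarefree hRsq hTR, Finset.sum_eq_single_of_mem z₀ hz₀ fun z hz hne ↦ ?_]
  · rw [show (Lagrange.basis R.roots.toFinset id z₀).eval z₀ = (Lagrange.basis R.roots.toFinset id z₀).eval (id z₀) from rfl,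
      Lagrange.eval_basis_self (Set.injOn_id _) hz₀, mul_one]
  · rw [show (Lagrange.basis R.roots.toFinset id z₀).eval z = (Lagrange.basis R.roots.toFinset id z₀).eval (id z) from rfl,
      Lagrange.eval_basis_of_ne hne.symm hz, mul_zero]

end LinearAlgebra

/-! ## §1 `n_σ` is the multiplicity of `σ(φ)` as an eigenvalue of `t(φ)` on `T₀A` -/

section Multiplicity

variable (A : Motives.AbelianVariety ℂ) (φ : A ⟶ A)

/-- **«The dimension `n_σ` of `V^{1,0}_{ℂ,σ}` is called the multiplicity of `σ` on the tangent space of `X`»** — on the tree's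
carriers: `eigenMultiplicity A φ ρ = dim (Ker(φ^* − ρ) ∩ H^{1,0}(A))` EQUALS the multiplicity `dim Ker(t(φ) − ρ)` of `ρ` as an
eigenvalue of the analytic representation `t(φ) = dφ|₀` on `T₀A = Lie A` (transport along `H^{1,0} ≅ T_e^*A` and transpose).
[cite: MoonenZarhin1998WeilClasses, §1 (chunk p0001)] [cite: vanGeemen1994HodgeAV, 4.8 (chunk p0218)] -/
theorem eigenMultiplicity_eq_finrank_eigenspace_lieMap (ρ : ℂ) :
    eigenMultiplicity A φ ρ = finrank ℂ ↥(Module.End.eigenspace (lieMap A φ) ρ) :=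
  AbelianVariety.finrank_eigenspace_inf_hodgeOneZero_eq_finrank_eigenspace_lieMap _ rfl φ ρ

/-- `n_σ = dim Ker(φ^* − σ(φ) | 𝔪_e/𝔪_e²)` on the cotangent space (Shimura's `δφ` on `𝔇₀(A)`).
[cite: MoonenZarhin1998WeilClasses, §1 (chunk p0001)] [cite: Shimura1998, §2.8 (chunk p0027) and §5.2] -/
theorem eigenMultiplicity_eq_finrank_eigenspace_cotangentMap (ρ : ℂ) :
    eigenMultiplicity A φ ρ = finrank ℂ ↥(Module.End.eigenspace (cotangentMap A φ) ρ) :=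
  AbelianVariety.finrank_eigenspace_inf_hodgeOneZero_eq_finrank_eigenspace_cotangentMap _ rfl φ ρ

end Multiplicity

/-! ## §2 `T₀A = ⊕_σ Ker(t(φ) − σ(φ))`: `Σ_σ n_σ = dim A`, `Tr_a(Q(φ)) = Σ_σ n_σ Q(σ(φ))`, `n_σ = tr(e_σ)` -/

section Decomposition

variable {A : Motives.AbelianVariety ℂ} {φ : A ⟶ A} {P : ℤ[X]}

/-- `P_ℂ(t(φ)) = t(P(φ))`: the analytic representation `t : End(A) → End(T₀A)` is a ring homomorphism
(`Motives.AbelianVariety.lieMapRingHom`). [cite: vanGeemen1994HodgeAV, 4.8 (chunk p0218)] [cite: Shimura1998, §2.8 (chunk p0027)] -/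
theorem aeval_lieMap_map_eq (φ : A ⟶ A) (P : ℤ[X]) :
    aeval (lieMap A φ) (P.map (Int.castRingHom ℂ)) =
      lieMapRingHom A (P.eval₂ (Int.castRingHom (End A)) (φ : End A)) := by
  rw [aeval_def, eval₂_map, Polynomial.hom_eval₂,
    RingHom.ext_int ((algebraMap ℂ (Module.End ℂ (Lie A))).comp (Int.castRingHom ℂ))
      ((lieMapRingHom A).comp (Int.castRingHom (End A)))]
  rfl

/-- **`P(φ) = 0` in `End A` ⇒ `P(t(φ)) = 0` on `T₀A`.** [cite: vanGeemen1994HodgeAV, 4.8 (chunk p0218)] -/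
theorem aeval_lieMap_map_eq_zero (hφ : P.eval₂ (Int.castRingHom (End A)) (φ : End A) = 0) :
    aeval (lieMap A φ) (P.map (Int.castRingHom ℂ)) = 0 := by
  rw [aeval_lieMap_map_eq, hφ, map_zero]

/-- **«`n_σ + n_{σ′} = 2g/[F:ℚ]`» summed: `Σ_σ n_σ = dim A`** — `T₀A = ⊕_{P(z)=0} Ker(t(φ) − z)` for `P(φ) = 0` with simple
complex roots. [cite: MoonenZarhin1998WeilClasses, §1 (chunk p0001)] [cite: Deligne1982HodgeCycles, §4 (4.4)] -/
theorem sum_eigenMultiplicity_eq_dim (hP : Squarefree (P.map (Int.castRingHom ℂ)))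
    (hφ : P.eval₂ (Int.castRingHom (End A)) (φ : End A) = 0) :
    ∑ z ∈ (P.map (Int.castRingHom ℂ)).roots.toFinset, eigenMultiplicity A φ z = A.dim := by
  have h := finrank_eq_sum_of_squarefree hP (aeval_lieMap_map_eq_zero hφ)
  rw [finrank_lie] at h
  simp_rw [← eigenMultiplicity_eq_finrank_eigenspace_lieMap] at h
  exact_mod_cast h.symm

/-- **`tr(Q(t(φ)) | T₀A) = Σ_{P(z)=0} n_z · Q(z)`** for every `Q ∈ ℂ[T]`: on `T₀A = ⊕_z Ker(t(φ) − z)` the operator `Q(t(φ))` is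
the scalar `Q(z)` on the `z`-block of dimension `n_z`. [cite: MoonenZarhin1998WeilClasses, §1 (chunk p0001)] [cite: Shimura1998, §5.2 (p. 39)] -/
theorem trace_aeval_lieMap_eq_sum (hP : Squarefree (P.map (Int.castRingHom ℂ)))
    (hφ : P.eval₂ (Int.castRingHom (End A)) (φ : End A) = 0) (Q : ℂ[X]) :
    LinearMap.trace ℂ (Lie A) (aeval (lieMap A φ) Q) =
      ∑ z ∈ (P.map (Int.castRingHom ℂ)).roots.toFinset, (eigenMultiplicity A φ z : ℂ) * Q.eval z := by
  simp_rw [eigenMultiplicity_eq_finrank_eigenspace_lieMap]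
  exact trace_aeval_eq_sum_of_squarefree hP (aeval_lieMap_map_eq_zero hφ) Q

/-- **`Tr_a(φ) = Σ_σ n_σ · σ(φ)`**: the analytic trace of `φ` is the sum of the complex roots `z = σ(φ)` of `P` weighted by the
multiplicities `n_σ` — the analytic representation of `F = ℚ(φ)` on `T₀A` is `⊕_σ n_σ σ` (Shimura: «the `ω_i` form a basis of
`𝔇₀(A)`» with `δι(α)ω_i = α^{φ_i}ω_i`). [cite: MoonenZarhin1998WeilClasses, §1 (chunk p0001)] [cite: Shimura1998, §5.2 (p. 39)]
[cite: Deligne1982HodgeCycles, §4 (4.4)] -/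
theorem trace_lieMap_eq_sum_eigenMultiplicity_mul (hP : Squarefree (P.map (Int.castRingHom ℂ)))
    (hφ : P.eval₂ (Int.castRingHom (End A)) (φ : End A) = 0) :
    LinearMap.trace ℂ (Lie A) (lieMap A φ) =
      ∑ z ∈ (P.map (Int.castRingHom ℂ)).roots.toFinset, (eigenMultiplicity A φ z : ℂ) * z := by
  simp_rw [eigenMultiplicity_eq_finrank_eigenspace_lieMap]
  exact trace_eq_sum_of_squarefree hP (aeval_lieMap_map_eq_zero hφ)

/-- **`Tr_a(Q(φ)) = Σ_{P(z)=0} n_z · Q(z)` for `Q ∈ ℤ[T]`** — the analytic trace of every element of the order `ℤ[φ] ⊆ End A`.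
[cite: MoonenZarhin1998WeilClasses, §1 (chunk p0001)] [cite: Shimura1998, §5.2 (p. 39)] -/
theorem trace_lieMap_eval₂_eq_sum (hP : Squarefree (P.map (Int.castRingHom ℂ)))
    (hφ : P.eval₂ (Int.castRingHom (End A)) (φ : End A) = 0) (Q : ℤ[X]) :
    LinearMap.trace ℂ (Lie A) (lieMapRingHom A (Q.eval₂ (Int.castRingHom (End A)) (φ : End A))) =
      ∑ z ∈ (P.map (Int.castRingHom ℂ)).roots.toFinset,
        (eigenMultiplicity A φ z : ℂ) * Q.eval₂ (Int.castRingHom ℂ) z := by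
  rw [← aeval_lieMap_map_eq, trace_aeval_lieMap_eq_sum hP hφ]
  exact Finset.sum_congr rfl fun z _ ↦ by rw [Polynomial.eval_map]

/-- **`n_σ = tr(e_σ | T₀A)`**: for a complex root `z₀` of `P`, the multiplicity `n_{z₀}` is the trace on `T₀A` of the Lagrange
interpolation polynomial `L_{z₀}(t(φ))` at the roots (`L_{z₀}(z) = δ_{z z₀}`; `L_{z₀}(φ) = e_σ` is the idempotent of
`F ⊗ ℂ = Π_σ ℂ` cutting out the `σ`-summand `V_{ℂ,σ}`). [cite: MoonenZarhin1998WeilClasses, §1 (chunk p0001)] -/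
theorem eigenMultiplicity_eq_trace_aeval_lagrange (hP : Squarefree (P.map (Int.castRingHom ℂ)))
    (hφ : P.eval₂ (Int.castRingHom (End A)) (φ : End A) = 0) {z₀ : ℂ}
    (hz₀ : z₀ ∈ (P.map (Int.castRingHom ℂ)).roots.toFinset) :
    (eigenMultiplicity A φ z₀ : ℂ) =
      LinearMap.trace ℂ (Lie A) (aeval (lieMap A φ) (Lagrange.basis (P.map (Int.castRingHom ℂ)).roots.toFinset id z₀)) := by
  rw [eigenMultiplicity_eq_finrank_eigenspace_lieMap]
  exact finrank_eigenspace_eq_trace_aeval_lagrange hP (aeval_lieMap_map_eq_zero hφ) hz₀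

end Decomposition

end Literature.AlgebraicGeometry.HodgeTheory

/-! ## §3 Deligne's Weil-type CM data on `T₀A`: `a_ρ = k` for `t(η)`, `Tr_a(Q(η)) = k Σ_ρ Q(ρ)`, `Tr_a(η) = 0` -/

namespace Literature.AlgebraicGeometry.Deligne1982

section WeilTypeCM

open Literature.AlgebraicGeometry.HodgeTheory

variable {A : Motives.AbelianVariety ℂ} {η : A ⟶ A} {R : ℤ[X]} {e₀ k : ℕ}

/-- **`a_σ = k` ON THE TANGENT SPACE**: for Weil-type CM data `(A, η, R, e₀, k)` every complex root `ρ` of `P_R = R(T²)` is an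
eigenvalue of `t(η)` on `T₀A` of multiplicity exactly `k = d/2` («`a_σ = b_σ = d/2` for all `σ`»).
[cite: Deligne1982HodgeCycles, §4 (4.5) and Prop. 4.4] [cite: MoonenZarhin1998WeilClasses, §1 (chunk p0001)] -/
theorem IsWeilTypeCM.finrank_eigenspace_lieMap_eq (h : IsWeilTypeCM A η R e₀ k) {ρ : ℂ}
    (hρ : Polynomial.eval₂ (Int.castRingHom ℂ) ρ (R.comp (X ^ 2)) = 0) :
    finrank ℂ ↥(Module.End.eigenspace (lieMap A η) ρ) = k := by
  rw [← eigenMultiplicity_eq_finrank_eigenspace_lieMap]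
  exact h.multiplicity_eq ρ hρ

/-- **`Tr_a(Q(η)) = k · Σ_{P_R(ρ)=0} Q(ρ)`** for `Q ∈ ℤ[T]` on Weil-type CM data: the analytic representation of
`E = ℚ(η)` on `T₀A` is `k` copies of the regular embedding representation `⊕_σ σ`.
[cite: Deligne1982HodgeCycles, §4 (4.5)] [cite: MoonenZarhin1998WeilClasses, §1 (chunk p0001)] -/
theorem IsWeilTypeCM.trace_lieMap_eval₂_eq (h : IsWeilTypeCM A η R e₀ k) (Q : ℤ[X]) :
    LinearMap.trace ℂ (Lie A) (lieMapRingHom A (Q.eval₂ (Int.castRingHom (End A)) (η : End A))) =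
      k * ∑ z ∈ ((R.comp (X ^ 2)).map (Int.castRingHom ℂ)).roots.toFinset, Q.eval₂ (Int.castRingHom ℂ) z := by
  rw [trace_lieMap_eval₂_eq_sum h.squarefree_map_complex h.eval₂_eq_zero, Finset.mul_sum]
  refine Finset.sum_congr rfl fun z hz ↦ ?_
  have hR0 : R.comp (X ^ 2) ≠ 0 := h.monic_comp.ne_zero
  rw [h.multiplicity_eq z ((mem_roots_toFinset_map_iff hR0 z).1 hz)]

/-- **`Tr_a(η) = 0` on Weil-type CM data** — `Tr_a(η) = k Σ_ρ ρ` and the roots of `R(T²)` come in pairs `±ρ`; the CM-field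
generalisation of `IsWeilType.trace_lieMap_eq_zero` (imaginary quadratic `E`).
[cite: Deligne1982HodgeCycles, §4 (4.5)] [cite: MoonenZarhin1998WeilClasses, §1 (chunk p0001)] -/
theorem IsWeilTypeCM.trace_lieMap_eq_zero (h : IsWeilTypeCM A η R e₀ k) :
    LinearMap.trace ℂ (Lie A) (lieMap A η) = 0 := by
  classical
  have hX := h.trace_lieMap_eval₂_eq X
  simp only [eval₂_X] at hX
  rw [lieMapRingHom_apply] at hX
  change LinearMap.trace ℂ (Lie A) (lieMap A η) = _ at hX
  rw [hX]
  set S := ((R.comp (X ^ 2)).map (Int.castRingHom ℂ)).roots.toFinset with hS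
  -- the sum of the roots vanishes: `z ↦ -z` is an involution of `S` with `z + (-z) = 0`
  have hR0 : R.comp (X ^ 2) ≠ 0 := h.monic_comp.ne_zero
  have hsum : ∑ z ∈ S, z = 0 :=
    Finset.sum_involution (fun z _ ↦ -z) (fun z _ ↦ by rw [add_neg_cancel])
      (fun z hz hne ↦ by
        intro hzz
        have h0 : z = 0 := by linear_combination hzz / (-2)
        exact h.root_ne_zero ((mem_roots_toFinset_map_iff hR0 z).1 hz) h0)
      (fun z hz ↦ (mem_roots_toFinset_map_iff hR0 (-z)).2 (h.neg_root ((mem_roots_toFinset_map_iff hR0 z).1 hz)))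
      (fun z _ ↦ neg_neg z)
  rw [hsum, mul_zero]

end WeilTypeCM

end Literature.AlgebraicGeometry.Deligne1982
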